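import Literature.AlgebraicGeometry.Morphisms.CechModuleH2IsoTransfer
import Literature.AlgebraicGeometry.Morphisms.CechModuleH2MorphismTransfer
import Literature.AlgebraicGeometry.Morphisms.TorsionFreeIdealPowerTwist
import Literature.AlgebraicGeometry.Morphisms.CechH2FibreDimOneProjective
import Literature.AlgebraicGeometry.Resolution.ResolutionDominatedByBlowup
import Literature.AlgebraicGeometry.Resolution.ResolutionFibreDimension
import Literature.AlgebraicGeometry.Resolution.BlowupsIntegral
import Literature.AlgebraicGeometry.Resolution.BlowupSerreVanishingLocal
import HarnessLib

/-!
# `Ȟ² = 0` on a resolution of the spectrum of a two-dimensional Noetherian local domain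
# (Görtz–Wedhorn II Cor. 24.44 / Lipman (12.1) hypothesis, Čech form), from local Serre vanishing

For `A` a Noetherian local domain of Krull dimension `2` and `π : X → Spec A` a resolution of
singularities (`Resolution.IsResolution`: proper, birational, `X` regular; `X` integral and locally
Noetherian), every quasi-coherent `𝒪_X`-module `M` has `H²(X, M) = 0` — in the tree's Čech form:
`Ȟ²(𝒰, M) = 0` for every finite affine open cover (`Morphisms/CechModuleH2`).  In print this is the
special case `p = 2`, `d = dim π⁻¹(𝔪) ≤ 1` of Görtz–Wedhorn, *Algebraic Geometry II* (2023),
Cor. 24.44 ("for all `p > d` there exists an open neighborhood `V` of `s` such that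
`R^p f_* 𝓕|_V = 0`"), EGA III (4.2.2), Hartshorne III Cor. 11.2 — proved there by the theorem on
formal functions.  This file proves it WITHOUT formal functions, by the route
«domination + divisorial twist» (res-hironaka [INPUTS] route (δ), 2026-08-28):

1. (S1/S2, `Resolution/ResolutionDominatedByBlowup`, `Morphisms/NagataCompactificationProofs`) by
   Stacks 081T/080E there is a blow-up `b : S′ → Spec A` (projective over `A`, integral, birational,
   closed fibre of dimension `≤ 1`) dominating `π` through `r : S′ → X`, itself a blow-up of `X`
   along an ideal sheaf `J` which, after peeling off its divisorial part on the regular surface `X`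
   (`Resolution/DivisorialPart`, Auslander–Buchsbaum), is supported on a FINITE set `F` of closed
   points; `r` is an isomorphism over `Ω = X ∖ F`; on `S′` every `Ȟ²` of an affine-localizing module
   on an affine cover vanishes (`Morphisms/CechH2FibreDimOneProjective`, the projective case);
2. (S3–S5, `Morphisms/CechModuleH2IsoTransfer`, `…MorphismTransfer`) for an affine cover `𝒰′` of `X`
   in which every point of `F` lies in exactly one member, `Ȟ²(𝒰′, ·)` is invariant under morphisms
   bijective over the affine opens inside `Ω`, and `Ȟ²(𝒰′, r_* N) = 0` as soon as
   `H¹(r⁻¹U′_i, N) = 0` for all `i` and `H²(S′, N) = 0`;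
3. (S6, `Morphisms/TorsionFreeIdealPowerTwist` + the hypothesis `hLV`) for `M` coherent,
   the zig-zag `M → r_*r^*M → r_*P ← r_*(𝓙ⁿP)`, `P = r^*M/(𝓙-torsion)`, consists of morphisms
   bijective over `Ω`, and `H¹(r⁻¹U′_i, 𝓙ⁿP) = 0` for `n ≫ 0` by Serre's vanishing theorem on the
   blow-up charts `r⁻¹U = Bl_{J(U)}(U) ↪ 𝐏^m_{Γ(U)}` (`𝒪(1) = 𝓙`) — THIS LAST INPUT is taken here as
   the explicit hypothesis `hLV` (spelled out, not a named fact), to be supplied by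
   `Resolution/BlowupSerreVanishingLocal` (tree Serre A/B, `Modules/SerreTheoremA`,
   `Modules/SerreVanishingTwist`);
4. (S8) the passage from coherent to affine-localizing `M` is likewise taken as the spelled-out
   hypothesis `hext` ("a Čech `2`-cocycle on a finite affine cover lies in a coherent
   submodule", EGA I 9.4.7/9.4.9), to be supplied by the module form of
   `Limits/IdealSheafExtension`.

Results:
* `subsingleton_cechMH2_of_isResolution_of_coh_of_localVanishing` — coherent `M`, from `hLV`;
* (§3, appended) `subsingleton_cechMH2_of_isResolution_of_coh` — coherent `M`, UNCONDITIONAL (`hLV`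
  := `Resolution.exists_affine_family_cechMZ1_idealMul_pow_le_of_torsionFree`), with
  `cechMapH1_surjective_of_isResolution_of_coh` (`Ȟ¹` right exact for coherent kernels) and
  `subsingleton_cechMH2_of_isResolution_of_cocycleExtension` (affine-localizing `M` from `hext` alone);
* `subsingleton_cechMH2_of_isResolution_of_localVanishing_of_cocycleExtension` — affine-localizing
  `M`, finite affine cover, from `hLV` and `hext` — the binders of the W4.4 door
  `NoZeno.GWH2ResolutionDim2` verbatim (at universe `0`).

Scope: the REGULAR-`X` resolution instance over a `2`-dimensional local domain only; the instance
for a merely integral `Y` proper birational over `A` (`GWH2ProperBirationalDim2`) and the general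
Görtz–Wedhorn II Cor. 24.44 (`Morphisms/CechH2FibreDimOne.GortzWedhorn2023_24_44_H2`, a named fact)
are NOT reached.  Everything is proved; no named facts, no definitions; the two inputs are explicit
`Prop`-valued binders.  Mathlib searched (pin v4.32): `Scheme.isBasis_affineOpens`, `Set.Finite.isClosed_biUnion`,
`NoetherianSpace.isCompact`, `PrimeSpectrum.topologicalKrullDim_eq_ringKrullDim` (used).

## References

* U. Görtz, T. Wedhorn, *Algebraic Geometry II: Cohomology of Schemes*, Springer Spektrum (2023):
  Cor. 24.44, Thm. 22.9, Lemma 22.1. [GortzWedhorn2023]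
* J. Lipman, *Rational singularities …*, Publ. Math. IHÉS 36 (1969): §12, Thm. (12.1) (the
  hypothesis "`H²` vanishes on the resolution"). [Lipman1969]
* R. Hartshorne, *Algebraic Geometry* (1977): III Cor. 11.2, III Thm. 5.2 (b), II Ex. 5.6 (d),
  II Ex. 5.15. [Hartshorne1977]
* The Stacks Project, Tags 081T, 080E, 01ED, 01XD. [StacksProject]
-/

noncomputable section

-- `TopCat.Presheaf`/`TopCat.Sheaf` are not reducible (as in Mathlib's `AlgebraicGeometry/Modules`).
set_option backward.isDefEq.respectTransparency false

open CategoryTheory CategoryTheory.Limits AlgebraicGeometry TopologicalSpace IsLocalRing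
open Literature.AlgebraicGeometry.Resolution Literature.AlgebraicGeometry.Modules
open Literature.AlgebraicGeometry

universe u

namespace Literature.AlgebraicGeometry.Morphisms

/-! ## The two spelled-out hypotheses

Both theorems below carry their only non-tree inputs as EXPLICIT hypotheses (no named facts):

* `hLV` — **local Serre vanishing on blow-up charts**: for every blow-up `r : S′ → X` of `X` along
  an ideal sheaf `J` with `S′` integral Noetherian over `Spec A`, every affine open `U ⊆ X` and every
  coherent `𝒪_{S′}`-module `G` without `𝓙`-torsion (`𝓙 = J·𝒪_{S′}`), there is `d₀` such that for
  all `n ≥ d₀` every Čech `1`-cocycle of `𝓙ⁿG` on some family of affine opens with union `r⁻¹U` is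
  a coboundary ("`H¹(r⁻¹U, 𝓙ⁿG) = 0` for `n ≫ 0`": Serre, Hartshorne III Thm. 5.2 (b), on
  `r⁻¹U = Bl_{J(U)}(U) ↪ 𝐏^m_{Γ(U)}` with `𝒪(1) = 𝓙`);
* `hext` — **coherent extension of Čech cocycles**: a Čech `2`-cocycle of an affine-localizing
  module on a finite family of affine opens of the Noetherian `X` is the image of a `2`-cocycle of a
  COHERENT module `M′` under a morphism `M′ → M` (EGA I 9.4.7/9.4.9, Hartshorne II Ex. 5.15).
-/

/-! ## The adapted affine cover -/

section Cover

variable {X : Scheme.{u}} (F : Set X) (hFfin : F.Finite) (hFcl : ∀ x ∈ F, IsClosed ({x} : Set X))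

include hFfin hFcl in
/-- A finite set of closed points is closed. [folklore] -/
private theorem isClosed_of_finite_of_isClosed_singleton : IsClosed F := by
  have : F = ⋃ x ∈ F, {x} := (Set.biUnion_of_singleton F).symm
  rw [this]
  exact hFfin.isClosed_biUnion fun x hx => hFcl x hx

include hFfin hFcl in
/-- Each point of `F` has an affine neighbourhood meeting `F` only in that point. [folklore] -/
private theorem exists_affine_nhd_inter_subset (x : X) :
    ∃ V : X.affineOpens, x ∈ (V : X.Opens) ∧ ((V : X.Opens) : Set X) ⊆ (F \ {x})ᶜ := by
  have hcl : IsClosed (F \ {x}) :=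
    isClosed_of_finite_of_isClosed_singleton (F \ {x}) hFfin.sdiff fun y hy => hFcl y hy.1
  have hxW : x ∈ (⟨(F \ {x})ᶜ, hcl.isOpen_compl⟩ : X.Opens) := fun h => h.2 rfl
  obtain ⟨V, hV, hxV, hVle⟩ := (Opens.isBasis_iff_nbhd.mp X.isBasis_affineOpens) hxW
  exact ⟨⟨V, hV⟩, hxV, hVle⟩

end Cover

/-! ## `Ȟ² = 0` for coherent modules -/

section Main

variable {A : Type u} [CommRing A] [IsNoetherianRing A] [IsLocalRing A] [IsDomain A]
  {X : Scheme.{u}} [IsIntegral X] [IsLocallyNoetherian X] {π : X ⟶ Spec (.of A)}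

/-- **`Ȟ²(𝒰, M) = 0` on a resolution of a two-dimensional Noetherian local domain, for COHERENT
`M`, from local Serre vanishing on blow-up charts (`hLV`)**: for `A` a Noetherian local domain of Krull
dimension `2`, `π : X → Spec A` a resolution (`X` integral, locally Noetherian; `X` is then regular of
dimension `≤ 2`), `M` coherent and `𝒰` a family of affine opens covering `X`, every Čech `2`-cocycle
of `M` on `𝒰` is a `2`-coboundary.  Proof = route (δ): S2 domination `r : S′ → X` by a blow-up of
`Spec A` with centre `J` a finite set `F` of closed points of `X`
(`exists_isBlowup_dominating_codimTwo_finite`); S1 `Ȟ² = 0` on the projective `S′`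
(`subsingleton_cechMH2_of_isProjectiveOverRing`); an affine cover `𝒰′` of `X` adapted to `F`; S6 the
torsion-free twist package (`exists_torsionFree_idealPow_twist` + `hLV`); S4/S5
`subsingleton_cechMH2_pushforward_of_isIso_off`; S3 `subsingleton_cechMH2_iff_of_app_bijective_of_le`
three times (along `r_*ψ`, `r_*α`, and the unit `M → r_*r^*M`, `unit_app_bijective_of_le`); (c′)
`subsingleton_cechMH2_iff_of_isSeparated`.  This is the Čech form of Görtz–Wedhorn II Cor. 24.44 /
EGA III (4.2.2) for the resolution, proved without the theorem on formal functions.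
[cite: GortzWedhorn2023, Cor. 24.44 (resolution of a surface germ, coherent modules)] -/
theorem subsingleton_cechMH2_of_isResolution_of_coh_of_localVanishing (hA : ringKrullDim A = 2)
    (hπ : IsResolution π)
    (hLV : ∀ (S' : Scheme.{u}) [IsIntegral S'] [IsNoetherian S'] (fS : S' ⟶ Spec (.of A))
      (r : S' ⟶ X) (J : X.IdealSheafData), IsBlowup r J → ∀ (U : X.Opens), IsAffineOpen U →
      ∀ (G : S'.Modules), Coh G →
        (∀ (V : S'.Opens) (hV : IsAffineOpen V) (q : Γ(G, V)),
          (∀ a ∈ (J.comap r).ideal ⟨V, hV⟩, a • q = 0) → q = 0) →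
        ∃ d₀ : ℕ, ∀ n, d₀ ≤ n → ∃ (κ : Type u) (T : κ → S'.Opens),
          (∀ t, IsAffineOpen (T t)) ∧ ⨆ t, T t = r ⁻¹ᵁ U ∧
          cechMZ1 fS (idealMul G ((J.comap r) ^ n)) T ≤
            cechMB1 fS (idealMul G ((J.comap r) ^ n)) T)
    {M : X.Modules} (hM : Coh M) {ι : Type u}
    (U : ι → X.Opens) (hUaff : ∀ i, IsAffineOpen (U i)) (hcov : ⨆ i, U i = ⊤) :
    Subsingleton (CechMH2 π M U) := by
  classical
  haveI : IsProper π := hπ.isProper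
  haveI : X.IsSeparated := ⟨by rw [← Limits.terminal.comp_from π]; infer_instance⟩
  haveI : IsNoetherian X := by
    haveI : CompactSpace X := QuasiCompact.compactSpace_of_compactSpace π
    exact {}
  -- `dim X ≤ 2`
  have hdimX : topologicalKrullDim X ≤ 2 := by
    refine hπ.isBirational.topologicalKrullDim_le_of_isNoetherian.trans ?_
    change topologicalKrullDim (PrimeSpectrum A) ≤ 2
    rw [PrimeSpectrum.topologicalKrullDim_eq_ringKrullDim]
    exact hA.le
  -- S1/S2: domination by a blow-up of `Spec A`, centre on `X` of codimension two 
  obtain ⟨U₀, -, hU₀dense', hU₀iso⟩ := hπ.isBirational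
  haveI := hU₀iso
  have hne : ((π ⁻¹ᵁ U₀ : X.Opens) : Set X).Nonempty := hU₀dense'.nonempty
  obtain ⟨I, S', b, r, J, hb, hsupp, hcomp, hr, -, -, -, hfin, hcl, hiso⟩ :=
    exists_isBlowup_dominating_codimTwo_finite π hπ.isRegular hdimX U₀
      (NoetherianSpace.isCompact _) hne
  -- the blow-up `b : S' → Spec A` is projective, integral, birational, with fibres of dimension ≤ 1
  have hI : I ≠ ⊥ := by
    rintro rfl
    obtain ⟨x, hx⟩ := hne
    have huniv : ((U₀ : Set (Spec (.of A))))ᶜ = Set.univ := by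
      rw [← hsupp, Scheme.IdealSheafData.support_bot]
      rfl
    have hx' : π.base x ∈ ((U₀ : Set (Spec (.of A))))ᶜ := by rw [huniv]; trivial
    exact hx' hx
  haveI : IsIntegral S' := hb.isIntegral hI
  have hproj : Crystalline.IsProjectiveOverRing (Over.mk b : Motives.SchemeOver A) :=
    hb.isProjectiveOverRing_of_isAffine
  haveI : IsProper b := isProper_of_isProjectiveOverRing b hproj
  haveI : S'.IsSeparated := ⟨by rw [← Limits.terminal.comp_from b]; infer_instance⟩
  haveI : IsNoetherian S' := by
    haveI : IsLocallyNoetherian S' := LocallyOfFiniteType.isLocallyNoetherian b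
    haveI : CompactSpace S' := QuasiCompact.compactSpace_of_compactSpace b
    exact {}
  have hbir : IsBirational b := hb.isBirational' hI
  have hfib : topologicalKrullDim (b.fiber (closedPoint A)) ≤ 1 :=
    topologicalKrullDim_fiber_le_one_of_isBirational hA.le hbir (closedPoint A)
  -- S1 = (d′): `Ȟ² = 0` on `S'` for every affine-localizing module and every affine cover 
  have hS1 : ∀ {N : S'.Modules}, IsAffineLocalizing N → ∀ (κ : Type u) (T : κ → S'.Opens),
      (∀ t, IsAffineOpen (T t)) → ⨆ t, T t = ⊤ → cechMZ2 b N T ≤ cechMB2 b N T :=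
    fun hN κ T hT hTcov => (subsingleton_cechMH2_iff b _ T).mp
      (subsingleton_cechMH2_of_isProjectiveOverRing b hproj hfib hN T hT hTcov)
  -- the finite set `F` of fundamental points and `Ω = X ∖ F`
  set F : Set X := (J.support : Set X) with hFdef
  let Ω : X.Opens := ⟨(J.support : Set X)ᶜ, J.support.isClosed.isOpen_compl⟩
  haveI hΩiso : IsIso (r ∣_ Ω) := hiso
  have hFclosed : IsClosed F := isClosed_of_finite_of_isClosed_singleton F hfin hcl
  -- the adapted cover: affine neighbourhoods of the points of `F` meeting `F` once, affines off `F`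
  have hx : ∀ x : F, ∃ V : X.affineOpens, (x : X) ∈ (V : X.Opens) ∧
      ((V : X.Opens) : Set X) ⊆ (F \ {(x : X)})ᶜ :=
    fun x => exists_affine_nhd_inter_subset F hfin hcl x
  choose Ux hUxmem hUxsub using hx
  let ι' : Type u := F ⊕ {V : X.affineOpens // ((V : X.Opens) : Set X) ⊆ Fᶜ}
  let U' : ι' → X.Opens := Sum.elim (fun x => (Ux x : X.Opens)) (fun V => (V.1 : X.Opens))
  have hU'aff : ∀ i, IsAffineOpen (U' i) := by
    rintro (x | V)
    · exact (Ux x).2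
    · exact V.1.2
  have hU'cov : ⨆ i, U' i = ⊤ := by
    refine top_le_iff.mp fun p _ => ?_
    by_cases hp : p ∈ F
    · exact Opens.mem_iSup.mpr ⟨Sum.inl ⟨p, hp⟩, hUxmem ⟨p, hp⟩⟩
    · have hpW : p ∈ (⟨Fᶜ, hFclosed.isOpen_compl⟩ : X.Opens) := hp
      obtain ⟨V, hV, hpV, hVle⟩ := (Opens.isBasis_iff_nbhd.mp X.isBasis_affineOpens) hpW
      exact Opens.mem_iSup.mpr ⟨Sum.inr ⟨⟨V, hV⟩, hVle⟩, hpV⟩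
  have hUxF : ∀ (x : F) (p : X), p ∈ (Ux x : X.Opens) → p ∈ F → p = x := by
    intro x p hp hpF
    by_contra h
    exact hUxsub x hp ⟨hpF, h⟩
  have hΩ : ∀ i j, i ≠ j → U' i ⊓ U' j ≤ Ω := by
    rintro (x | V) (y | W) hne p hp hpF
    · have h1 := hUxF x p hp.1 hpF
      have h2 := hUxF y p hp.2 hpF
      exact hne (congrArg Sum.inl (Subtype.ext (h1.symm.trans h2)))
    · exact W.2 hp.2 hpF
    · exact V.2 hp.1 hpF
    · exact V.2 hp.1 hpF
  have hVΩ : ∀ V : {V : X.affineOpens // ((V : X.Opens) : Set X) ⊆ Fᶜ}, U' (Sum.inr V) ≤ Ω :=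
    fun V p hp => V.2 hp
  -- S6: the torsion-free twist package for the finitely many members meeting `F` (p621622),
  -- fed with the local vanishing `hLV` on the blow-up charts `r⁻¹U_x ≅ Bl_{J(U_x)} U_x`
  haveI : Finite F := hfin.to_subtype
  obtain ⟨P, N, α, ψ, hN, hαψ, hH1⟩ := exists_torsionFree_idealPow_twist b r J M hM
    (fun x : F => (Ux x : X.Opens)) fun G hG htf x =>
      hLV S' b r J hr (Ux x) (Ux x).2 G hG htf
  -- S4 + S5: `Ȟ²(𝒰', r_* N) = 0` 
  have hQ : Subsingleton (CechMH2 π ((Scheme.Modules.pushforward r).obj N) U') := by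
    refine subsingleton_cechMH2_pushforward_of_isIso_off π b r U' hU'aff hU'cov Ω hΩ hN hcomp ?_
      (fun κ T hT hTcov => hS1 hN κ T hT hTcov)
    rintro (x | V)
    · exact hH1 x
    · exact exists_affine_family_cechMZ1_le_of_le b r U' hU'aff Ω hN (Sum.inr V) (hVΩ V)
  -- S3 along `r_* ψ : r_* N → r_* P` and `r_* α : r_* r^* M → r_* P` 
  have hdisj : ∀ V : X.Opens, V ≤ Ω → Disjoint (V : Set X) J.support :=
    fun V hVΩ => Set.disjoint_left.mpr fun p hp => hVΩ hp
  have hraff : ∀ V : X.Opens, IsAffineOpen V → V ≤ Ω → IsAffineOpen (r ⁻¹ᵁ V) := by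
    intro V hV hVΩ
    haveI := isIso_morphismRestrict_of_le r hVΩ
    exact isAffineOpen_preimage_of_isIso_morphismRestrict r hV
  have hP : Subsingleton (CechMH2 π ((Scheme.Modules.pushforward r).obj P) U') :=
    (subsingleton_cechMH2_iff_of_app_bijective_of_le π U' ((Scheme.Modules.pushforward r).map ψ)
      hU'aff Ω hΩ (fun V hV hVΩ => (hαψ V hV (hdisj V hVΩ) (hraff V hV hVΩ)).2)).mp hQ
  have hP' : Subsingleton (CechMH2 π ((Scheme.Modules.pushforward r).obj
      ((Scheme.Modules.pullback r).obj M)) U') :=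
    (subsingleton_cechMH2_iff_of_app_bijective_of_le π U' ((Scheme.Modules.pushforward r).map α)
      hU'aff Ω hΩ (fun V hV hVΩ => (hαψ V hV (hdisj V hVΩ) (hraff V hV hVΩ)).1)).mpr hP
  -- S3 along the unit `η : M → r_* r^* M` (tree `unit_app_bijective_of_le`)
  have hM' : Subsingleton (CechMH2 π M U') :=
    (subsingleton_cechMH2_iff_of_app_bijective_of_le π U'
      ((Scheme.Modules.pullbackPushforwardAdjunction r).unit.app M) hU'aff Ω hΩ
      (fun V hV hVΩ => unit_app_bijective_of_le r M hM.loc hV hVΩ)).mpr hP'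
  -- any finite affine cover, by (c′) 
  exact (subsingleton_cechMH2_iff_of_isSeparated π hM.loc U' U hU'aff hUaff hU'cov hcov).mp hM'


/-- **`Ȟ²(𝒰, M) = 0` on a resolution of a two-dimensional Noetherian local domain, for every
affine-localizing (quasi-coherent) `M` and every finite affine open cover** — the binders of the
W4.4 door `NoZeno.GWH2ResolutionDim2` — from `hLV` (local Serre vanishing) and `hext` (coherent extension of cocycles): a
`2`-cocycle of `M` comes from a `2`-cocycle of a coherent `M′`, which bounds by the coherent case.
[cite: GortzWedhorn2023, Cor. 24.44 (resolution of a surface germ)] -/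
theorem subsingleton_cechMH2_of_isResolution_of_localVanishing_of_cocycleExtension
    (hA : ringKrullDim A = 2) (hπ : IsResolution π)
    (hLV : ∀ (S' : Scheme.{u}) [IsIntegral S'] [IsNoetherian S'] (fS : S' ⟶ Spec (.of A))
      (r : S' ⟶ X) (J : X.IdealSheafData), IsBlowup r J → ∀ (U : X.Opens), IsAffineOpen U →
      ∀ (G : S'.Modules), Coh G →
        (∀ (V : S'.Opens) (hV : IsAffineOpen V) (q : Γ(G, V)),
          (∀ a ∈ (J.comap r).ideal ⟨V, hV⟩, a • q = 0) → q = 0) →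
        ∃ d₀ : ℕ, ∀ n, d₀ ≤ n → ∃ (κ : Type u) (T : κ → S'.Opens),
          (∀ t, IsAffineOpen (T t)) ∧ ⨆ t, T t = r ⁻¹ᵁ U ∧
          cechMZ1 fS (idealMul G ((J.comap r) ^ n)) T ≤
            cechMB1 fS (idealMul G ((J.comap r) ^ n)) T)
    (hext : ∀ (ι : Type u) [Finite ι] (U : ι → X.Opens), (∀ i, IsAffineOpen (U i)) →
      ∀ (M : X.Modules), IsAffineLocalizing M → ∀ z : CechMC2 π M U, z ∈ cechMZ2 π M U →
        ∃ (M' : X.Modules) (φ : M' ⟶ M) (z' : CechMC2 π M' U),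
          Coh M' ∧ z' ∈ cechMZ2 π M' U ∧ cechMapC2 π φ U z' = z)
    {M : X.Modules} (hM : IsAffineLocalizing M) {ι : Type u} [Finite ι]
    (U : ι → X.Opens) (hUaff : ∀ i, IsAffineOpen (U i)) (hcov : ⨆ i, U i = ⊤) :
    Subsingleton (CechMH2 π M U) := by
  classical
  haveI : IsProper π := hπ.isProper
  haveI : IsNoetherian X := by
    haveI : CompactSpace X := QuasiCompact.compactSpace_of_compactSpace π
    exact {}
  rw [subsingleton_cechMH2_iff]
  intro z hz
  obtain ⟨M', φ, z', hM', hz', rfl⟩ := hext ι U hUaff M hM z hz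
  have h := (subsingleton_cechMH2_iff π M' U).mp
    (subsingleton_cechMH2_of_isResolution_of_coh_of_localVanishing hA hπ hLV hM' U hUaff hcov)
  exact mapC2_mem_cechMB2 π φ U (h hz')

/-! ## §3 (APPENDED 2026-08-28): the coherent case UNCONDITIONALLY — `hLV` supplied by
`Resolution/BlowupSerreVanishingLocal.exists_affine_family_cechMZ1_idealMul_pow_le_of_torsionFree`
(Serre's vanishing theorem on the blow-up charts, res-inputs-p-9c) -/

/-- **`Ȟ²(𝒰, M) = 0` on a resolution of the spectrum of a two-dimensional Noetherian local domain,
for every COHERENT `M` and every family of affine opens covering `X`** — Görtz–Wedhorn II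
Cor. 24.44 / EGA III (4.2.2) / the `H²`-hypothesis of Lipman (12.1) for the resolution and coherent
modules, PROVED without the theorem on formal functions (route (δ): the local Serre vanishing `hLV`
of `subsingleton_cechMH2_of_isResolution_of_coh_of_localVanishing` is the tree theorem
`Resolution.exists_affine_family_cechMZ1_idealMul_pow_le_of_torsionFree`).
[cite: GortzWedhorn2023, Cor. 24.44 (resolution of a surface germ, coherent modules)] -/
theorem subsingleton_cechMH2_of_isResolution_of_coh (hA : ringKrullDim A = 2) (hπ : IsResolution π)
    {M : X.Modules} (hM : Coh M) {ι : Type u} (U : ι → X.Opens) (hUaff : ∀ i, IsAffineOpen (U i))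
    (hcov : ⨆ i, U i = ⊤) : Subsingleton (CechMH2 π M U) :=
  subsingleton_cechMH2_of_isResolution_of_coh_of_localVanishing hA hπ
    (fun _S' _ _ fS r J hr V hV G hG htf =>
      Literature.AlgebraicGeometry.Resolution.exists_affine_family_cechMZ1_idealMul_pow_le_of_torsionFree
        fS r J hr V hV G hG htf)
    hM U hUaff hcov

/-- **`Ȟ¹` is right exact on a resolution of a two-dimensional Noetherian local domain, for short
exact sequences with COHERENT kernel**, unconditionally: for `0 → M′ → M → M″ → 0` with `M′`
coherent and any family of affine opens covering `X`, `Ȟ¹(𝒰, M) → Ȟ¹(𝒰, M″)` is surjective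
(the long exact Čech sequence, `cechMapH1_surjective_of_shortExact`, fed with
`subsingleton_cechMH2_of_isResolution_of_coh`). [cite: GortzWedhorn2023, Cor. 24.44 (resolution of a surface germ)] -/
theorem cechMapH1_surjective_of_isResolution_of_coh (hA : ringKrullDim A = 2) (hπ : IsResolution π)
    {S : ShortComplex X.Modules} (hS : S.ShortExact) (h₁ : Coh S.X₁) {ι : Type u}
    (U : ι → X.Opens) (hUaff : ∀ i, IsAffineOpen (U i)) (hcov : ⨆ i, U i = ⊤) :
    Function.Surjective (cechMapH1 π S.g U) := by
  haveI : IsProper π := hπ.isProper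
  haveI : X.IsSeparated := ⟨by rw [← Limits.terminal.comp_from π]; infer_instance⟩
  exact cechMapH1_surjective_of_shortExact π U hS h₁.loc hUaff (fun i j => (hUaff i).inf (hUaff j))
    (subsingleton_cechMH2_of_isResolution_of_coh hA hπ h₁ U hUaff hcov)

/-- **The affine-localizing case modulo the cocycle-extension input only** (`hext`, EGA I 9.4.9;
S8 of the route): `Ȟ²(𝒰, M) = 0` for every affine-localizing `M` and every finite family of affine
opens covering `X`. [cite: GortzWedhorn2023, Cor. 24.44 (resolution of a surface germ)] -/
theorem subsingleton_cechMH2_of_isResolution_of_cocycleExtension (hA : ringKrullDim A = 2)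
    (hπ : IsResolution π)
    (hext : ∀ (ι : Type u) [Finite ι] (U : ι → X.Opens), (∀ i, IsAffineOpen (U i)) →
      ∀ (M : X.Modules), IsAffineLocalizing M → ∀ z : CechMC2 π M U, z ∈ cechMZ2 π M U →
        ∃ (M' : X.Modules) (φ : M' ⟶ M) (z' : CechMC2 π M' U),
          Coh M' ∧ z' ∈ cechMZ2 π M' U ∧ cechMapC2 π φ U z' = z)
    {M : X.Modules} (hM : IsAffineLocalizing M) {ι : Type u} [Finite ι]
    (U : ι → X.Opens) (hUaff : ∀ i, IsAffineOpen (U i)) (hcov : ⨆ i, U i = ⊤) :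
    Subsingleton (CechMH2 π M U) := by
  classical
  haveI : IsProper π := hπ.isProper
  haveI : IsNoetherian X := by
    haveI : CompactSpace X := QuasiCompact.compactSpace_of_compactSpace π
    exact {}
  rw [subsingleton_cechMH2_iff]
  intro z hz
  obtain ⟨M', φ, z', hM', hz', rfl⟩ := hext ι U hUaff M hM z hz
  have h := (subsingleton_cechMH2_iff π M' U).mp
    (subsingleton_cechMH2_of_isResolution_of_coh hA hπ hM' U hUaff hcov)
  exact mapC2_mem_cechMB2 π φ U (h hz')

end Main

end Literature.AlgebraicGeometry.Morphisms

end
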